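import Summits.CriticalPhenomena.PercolationContinuityZ3.Theorems.PercNearOneGluingNoHeavyLowerTailSahiOneStepRayleighMatroidMinor
import HarnessLib

/-!
# Rayleigh down-closed families of finite sets are matroid complexes

Support file (prover prim-ineq-prove-3 gen 34; `--supports stmt-CriticalPhenomena-4575`; memo FINDING-G33-KERNEL-FORMS.md §7.3′).
THEOREM (`exists_matroid_of_isRayleighFamily`): a nonempty down-closed family `𝓛 ⊆ 2^ι` whose coordinates are pairwise
non-positively correlated under EVERY product measure conditioned on `𝓛` (`IsRayleighFamily`, the closed-cube form of Wagner's
Rayleigh condition) is the family of independent sets of a matroid on `ι` (Mathlib `Matroid`, via `IndepMatroid.ofFinset`).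
This is the down-closed case of [Wagner 2008, Thm 4.6] ("Rayleigh set systems are convex delta-matroids"), with a direct
elementary proof: the augmentation property `exists_insert_mem_of_card_lt` by induction on `|I|`, contracting a common element
of `I, J`, or — when `I ∩ J = ∅` — producing `j₁, j₂ ∈ J` with `I − g + j₁ + j₂ ∈ 𝓛` from the induction hypothesis (once in `𝓛`,
once in the contraction by `j₁`) and concluding by the EXCHANGE STEP `insert_insert_mem_or`: if `A+g, A+j₁+j₂ ∈ 𝓛` then
`A+g+j₁ ∈ 𝓛` or `A+g+j₂ ∈ 𝓛`, because otherwise the minor `𝓛/A` on `{g,j₁,j₂}` is the five-set complex `{∅,g,j₁,j₂,j₁j₂}`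
(complement of the AND–OR slot of `…SahiOneStepNonMatroidSlot`), whose Rayleigh inequality for `(j₁,j₂)` at density `1/2`
would read `1·5 ≤ 2·2`.  No definitions, no named facts, no sorries, no `native_decide`.
-/

noncomputable section

namespace Summit.CriticalPhenomena.PercolationContinuityZ3.Theorems

namespace SahiOneStep

open Finset

variable {ι : Type*} [Fintype ι] [DecidableEq ι]

/-! ## The uniform density `1/2`: masses are cardinalities -/

/-- At the uniform density `1/2` every set has weight `2^{-|ι|}`. [folklore] -/
theorem rwt_half (S : Finset ι) : rwt (fun _ : ι => (1 / 2 : ℝ)) S = (1 / 2 : ℝ) ^ Fintype.card ι := by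
  unfold rwt
  rw [Finset.prod_congr rfl (fun i _ => show (if i ∈ S then (1 / 2 : ℝ) else 1 - 1 / 2) = 1 / 2 by
    split_ifs <;> norm_num), Finset.prod_const, Finset.card_univ]

/-- At the uniform density `1/2` the mass of a family is `2^{-|ι|}` times its cardinality. [folklore] -/
theorem rmass_half (𝓐 : Finset (Finset ι)) :
    rmass (fun _ : ι => (1 / 2 : ℝ)) 𝓐 = (1 / 2 : ℝ) ^ Fintype.card ι * 𝓐.card := by
  unfold rmass
  rw [Finset.sum_congr rfl (fun S _ => rwt_half S), Finset.sum_const, nsmul_eq_mul, mul_comm]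

/-! ## The smallest non-matroidal pattern is not Rayleigh -/

/-- **Exchange step forced by the Rayleigh condition.**  In a Rayleigh down-closed family, if `A + g ∈ 𝓛` and
`A + j₁ + j₂ ∈ 𝓛` (with `g, j₁, j₂ ∉ A` distinct) then `A + g + j₁ ∈ 𝓛` or `A + g + j₂ ∈ 𝓛`.  Otherwise the minor
`𝓛 / A` restricted to `{g, j₁, j₂}` is the five-element complex `{∅, g, j₁, j₂, j₁j₂}` (the complement of the AND–OR slot
`x_g ∧ (x_{j₁} ∨ x_{j₂})`, cf. `osN_andOr_slot_neg`), for which at density `1/2` the Rayleigh inequality for the pair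
`(j₁, j₂)` reads `1·5 ≤ 2·2`. [cite: Wagner2008, Thm 4.6 (base of the exchange argument)] -/
theorem insert_insert_mem_or {𝓛 : Finset (Finset ι)} (h𝓛 : IsRayleighFamily 𝓛) (hD : IsLowerSet (𝓛 : Set (Finset ι)))
    {A : Finset ι} {g j₁ j₂ : ι} (hgA : g ∉ A) (hj₁A : j₁ ∉ A) (hj₂A : j₂ ∉ A) (hgj₁ : g ≠ j₁) (hgj₂ : g ≠ j₂)
    (hj₁₂ : j₁ ≠ j₂) (hAg : insert g A ∈ 𝓛) (hAjj : insert j₁ (insert j₂ A) ∈ 𝓛) :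
    insert j₁ (insert g A) ∈ 𝓛 ∨ insert j₂ (insert g A) ∈ 𝓛 := by
  classical
  by_contra hcon
  rw [not_or] at hcon
  obtain ⟨h1, h2⟩ := hcon
  set G : Finset ι := {g, j₁, j₂} with hG
  set D : Finset ι := univ \ (A ∪ G) with hDdef
  have hAD : Disjoint A D := by
    rw [hDdef]; exact Finset.disjoint_of_subset_left Finset.subset_union_left Finset.disjoint_sdiff
  have hR : IsRayleighFamily (fminor A D 𝓛) := isRayleighFamily_fminor h𝓛 hAD
  -- subsets of `G` avoid `A ∪ D`
  have hGA : Disjoint G A := by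
    rw [hG, Finset.disjoint_insert_left, Finset.disjoint_insert_left, Finset.disjoint_singleton_left]
    exact ⟨hgA, hj₁A, hj₂A⟩
  have havoid : ∀ T : Finset ι, T ⊆ G → Disjoint (A ∪ D) T := by
    intro T hT
    rw [Finset.disjoint_union_left]
    refine ⟨Finset.disjoint_of_subset_right hT hGA.symm, ?_⟩
    rw [hDdef]
    exact Finset.disjoint_of_subset_right (hT.trans Finset.subset_union_right) Finset.sdiff_disjoint
  -- conversely members of the minor are subsets of `G`
  have hsubG : ∀ T : Finset ι, Disjoint (A ∪ D) T → T ⊆ G := by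
    intro T hT x hx
    have hx' : x ∉ A ∪ D := fun h => Finset.disjoint_left.mp hT h hx
    rw [Finset.mem_union, not_or, hDdef, Finset.mem_sdiff, not_and, not_not] at hx'
    have := hx'.2 (Finset.mem_univ x)
    rcases Finset.mem_union.mp this with hxA | hxG
    · exact absurd hxA hx'.1
    · exact hxG
  -- union with `A` of small sets
  have hu0 : (∅ : Finset ι) ∪ A = A := Finset.empty_union A
  have hu1 : ∀ x : ι, ({x} : Finset ι) ∪ A = insert x A := fun x => (Finset.insert_eq x A).symm
  have hu2 : ∀ x y : ι, ({x, y} : Finset ι) ∪ A = insert x (insert y A) := fun x y => by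
    rw [Finset.insert_union, ← Finset.insert_eq]
  have hA : A ∈ 𝓛 := hD (Finset.subset_insert g A) hAg
  have hAj₁ : insert j₁ A ∈ 𝓛 := hD (Finset.insert_subset_insert j₁ (Finset.subset_insert j₂ A)) hAjj
  have hAj₂ : insert j₂ A ∈ 𝓛 := hD (Finset.subset_insert j₁ _) hAjj
  -- the five members
  have hmem : ∀ T : Finset ι, T ⊆ G → T ∪ A ∈ 𝓛 → T ∈ fminor A D 𝓛 := fun T hT hTA =>
    (mem_fminor hAD).mpr ⟨havoid T hT, hTA⟩
  have hgG : ({g} : Finset ι) ⊆ G := by rw [hG]; intro x hx; simp_all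
  have hj₁G : ({j₁} : Finset ι) ⊆ G := by rw [hG]; intro x hx; simp_all
  have hj₂G : ({j₂} : Finset ι) ⊆ G := by rw [hG]; intro x hx; simp_all
  have hjjG : ({j₁, j₂} : Finset ι) ⊆ G := by rw [hG]; intro x hx; simp_all
  have m0 : (∅ : Finset ι) ∈ fminor A D 𝓛 := hmem ∅ (Finset.empty_subset G) (by rw [hu0]; exact hA)
  have mg : ({g} : Finset ι) ∈ fminor A D 𝓛 := hmem {g} hgG (by rw [hu1]; exact hAg)
  have mj₁ : ({j₁} : Finset ι) ∈ fminor A D 𝓛 := hmem {j₁} hj₁G (by rw [hu1]; exact hAj₁)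
  have mj₂ : ({j₂} : Finset ι) ∈ fminor A D 𝓛 := hmem {j₂} hj₂G (by rw [hu1]; exact hAj₂)
  have mjj : ({j₁, j₂} : Finset ι) ∈ fminor A D 𝓛 := hmem {j₁, j₂} hjjG (by rw [hu2]; exact hAjj)
  -- lower bound on the total mass: the five members are distinct
  set 𝓔 : Finset (Finset ι) := {∅, {g}, {j₁}, {j₂}, {j₁, j₂}} with h𝓔
  have h𝓔sub : 𝓔 ⊆ fminor A D 𝓛 := by
    rw [h𝓔]; intro T hT
    simp only [Finset.mem_insert, Finset.mem_singleton] at hT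
    rcases hT with rfl | rfl | rfl | rfl | rfl
    exacts [m0, mg, mj₁, mj₂, mjj]
  have hne1 : ({g} : Finset ι) ≠ {j₁, j₂} := fun h => by
    have : j₂ ∈ ({g} : Finset ι) := by rw [h]; simp
    rw [Finset.mem_singleton] at this; exact hgj₂ this.symm
  have hne2 : ({j₁} : Finset ι) ≠ {j₁, j₂} := fun h => by
    have : j₂ ∈ ({j₁} : Finset ι) := by rw [h]; simp
    rw [Finset.mem_singleton] at this; exact hj₁₂ this.symm
  have hne3 : ({j₂} : Finset ι) ≠ {j₁, j₂} := fun h => by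
    have : j₁ ∈ ({j₂} : Finset ι) := by rw [h]; simp
    rw [Finset.mem_singleton] at this; exact hj₁₂ this
  have h𝓔card : 𝓔.card = 5 := by
    rw [h𝓔, Finset.card_insert_of_notMem, Finset.card_insert_of_notMem, Finset.card_insert_of_notMem,
      Finset.card_pair hne3]
    · simp only [Finset.mem_insert, Finset.mem_singleton, Finset.singleton_inj, not_or]
      exact ⟨hj₁₂, hne2⟩
    · simp only [Finset.mem_insert, Finset.mem_singleton, Finset.singleton_inj, not_or]
      exact ⟨hgj₁, hgj₂, hne1⟩
    · simp only [Finset.mem_insert, Finset.mem_singleton, not_or]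
      exact ⟨(Finset.singleton_ne_empty g).symm, (Finset.singleton_ne_empty j₁).symm,
        (Finset.singleton_ne_empty j₂).symm, (Finset.insert_ne_empty j₁ {j₂}).symm⟩
  have hcard : 5 ≤ (fminor A D 𝓛).card := h𝓔card ▸ Finset.card_le_card h𝓔sub
  -- the pair event
  have hcard_ef : 1 ≤ ((fminor A D 𝓛).filter fun S => j₁ ∈ S ∧ j₂ ∈ S).card := by
    rw [Nat.one_le_iff_ne_zero, Ne, Finset.card_eq_zero, ← Ne, ← Finset.nonempty_iff_ne_empty]
    exact ⟨{j₁, j₂}, Finset.mem_filter.mpr ⟨mjj, by simp⟩⟩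
  -- upper bounds on the singleton events: no member containing `jᵢ` contains `g`
  have hnog : ∀ T ∈ fminor A D 𝓛, j₁ ∈ T ∨ j₂ ∈ T → g ∉ T := by
    intro T hT hj hgT
    have hTA := ((mem_fminor hAD).mp hT).2
    rcases hj with hj | hj
    · exact h1 (hD (show insert j₁ (insert g A) ⊆ T ∪ A by
        intro x hx
        simp only [Finset.mem_insert, Finset.mem_union] at hx ⊢
        rcases hx with rfl | rfl | hx
        exacts [Or.inl hj, Or.inl hgT, Or.inr hx]) hTA)
    · exact h2 (hD (show insert j₂ (insert g A) ⊆ T ∪ A by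
        intro x hx
        simp only [Finset.mem_insert, Finset.mem_union] at hx ⊢
        rcases hx with rfl | rfl | hx
        exacts [Or.inl hj, Or.inl hgT, Or.inr hx]) hTA)
  have hsub_e : ((fminor A D 𝓛).filter fun S => j₁ ∈ S) ⊆ {{j₁}, {j₁, j₂}} := by
    intro T hT
    obtain ⟨hT, hj₁T⟩ := Finset.mem_filter.mp hT
    have hTG := hsubG T (disjoint_of_mem_fminor hT)
    have hgT := hnog T hT (Or.inl hj₁T)
    simp only [Finset.mem_insert, Finset.mem_singleton]
    by_cases hj₂T : j₂ ∈ T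
    · right; ext x; constructor
      · intro hx
        have := hTG hx; rw [hG] at this
        simp only [Finset.mem_insert, Finset.mem_singleton] at this ⊢
        rcases this with rfl | rfl | rfl
        · exact absurd hx hgT
        · exact Or.inl rfl
        · exact Or.inr rfl
      · intro hx; simp only [Finset.mem_insert, Finset.mem_singleton] at hx
        rcases hx with rfl | rfl
        exacts [hj₁T, hj₂T]
    · left; ext x; constructor
      · intro hx
        have := hTG hx; rw [hG] at this
        simp only [Finset.mem_insert, Finset.mem_singleton] at this ⊢
        rcases this with rfl | rfl | rfl
        · exact absurd hx hgT
        · rfl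
        · exact absurd hx hj₂T
      · intro hx; rw [Finset.mem_singleton] at hx; subst hx; exact hj₁T
  have hsub_f : ((fminor A D 𝓛).filter fun S => j₂ ∈ S) ⊆ {{j₂}, {j₁, j₂}} := by
    intro T hT
    obtain ⟨hT, hj₂T⟩ := Finset.mem_filter.mp hT
    have hTG := hsubG T (disjoint_of_mem_fminor hT)
    have hgT := hnog T hT (Or.inr hj₂T)
    simp only [Finset.mem_insert, Finset.mem_singleton]
    by_cases hj₁T : j₁ ∈ T
    · right; ext x; constructor
      · intro hx
        have := hTG hx; rw [hG] at this
        simp only [Finset.mem_insert, Finset.mem_singleton] at this ⊢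
        rcases this with rfl | rfl | rfl
        · exact absurd hx hgT
        · exact Or.inl rfl
        · exact Or.inr rfl
      · intro hx; simp only [Finset.mem_insert, Finset.mem_singleton] at hx
        rcases hx with rfl | rfl
        exacts [hj₁T, hj₂T]
    · left; ext x; constructor
      · intro hx
        have := hTG hx; rw [hG] at this
        simp only [Finset.mem_insert, Finset.mem_singleton] at this ⊢
        rcases this with rfl | rfl | rfl
        · exact absurd hx hgT
        · exact absurd hx hj₁T
        · rfl
      · intro hx; rw [Finset.mem_singleton] at hx; subst hx; exact hj₂T
  have hcard_e : ((fminor A D 𝓛).filter fun S => j₁ ∈ S).card ≤ 2 :=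
    (Finset.card_le_card hsub_e).trans Finset.card_le_two
  have hcard_f : ((fminor A D 𝓛).filter fun S => j₂ ∈ S).card ≤ 2 :=
    (Finset.card_le_card hsub_f).trans Finset.card_le_two
  -- the Rayleigh inequality at density 1/2 for the pair (j₁, j₂)
  have H := hR (fun _ => (1 / 2 : ℝ)) (fun _ => by norm_num) (fun _ => by norm_num) j₁ j₂ hj₁₂
  rw [rmass_half, rmass_half, rmass_half, rmass_half] at H
  set c : ℝ := (1 / 2 : ℝ) ^ Fintype.card ι with hc
  have hc0 : 0 < c := by rw [hc]; positivity
  have e1 : (1 : ℝ) ≤ (((fminor A D 𝓛).filter fun S => j₁ ∈ S ∧ j₂ ∈ S).card : ℝ) := by exact_mod_cast hcard_ef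
  have e2 : (5 : ℝ) ≤ ((fminor A D 𝓛).card : ℝ) := by exact_mod_cast hcard
  have e3 : (((fminor A D 𝓛).filter fun S => j₁ ∈ S).card : ℝ) ≤ 2 := by exact_mod_cast hcard_e
  have e4 : (((fminor A D 𝓛).filter fun S => j₂ ∈ S).card : ℝ) ≤ 2 := by exact_mod_cast hcard_f
  have lhs : c * c * 5 ≤ c * (((fminor A D 𝓛).filter fun S => j₁ ∈ S ∧ j₂ ∈ S).card : ℝ) *
      (c * ((fminor A D 𝓛).card : ℝ)) := by
    have := mul_le_mul e1 e2 (by norm_num) (by linarith)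
    nlinarith [mul_pos hc0 hc0]
  have rhs : c * (((fminor A D 𝓛).filter fun S => j₁ ∈ S).card : ℝ) *
      (c * (((fminor A D 𝓛).filter fun S => j₂ ∈ S).card : ℝ)) ≤ c * c * 4 := by
    have h3 : (0 : ℝ) ≤ (((fminor A D 𝓛).filter fun S => j₁ ∈ S).card : ℝ) := by positivity
    have h4 : (0 : ℝ) ≤ (((fminor A D 𝓛).filter fun S => j₂ ∈ S).card : ℝ) := by positivity
    have := mul_le_mul e3 e4 h4 (by norm_num)
    nlinarith [mul_pos hc0 hc0]
  nlinarith [mul_pos hc0 hc0]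

/-! ## Augmentation -/

omit [Fintype ι] in
/-- `S ∪ {x} = insert x S`. [folklore] -/
theorem union_singleton_eq_insert (x : ι) (S : Finset ι) : S ∪ {x} = insert x S := by
  rw [Finset.union_comm, ← Finset.insert_eq]

/-- **Rayleigh + down-closed ⟹ matroid augmentation** (induction on `|I|`, contracting a common element or, when
`I ∩ J = ∅`, using the exchange step `insert_insert_mem_or` twice-prepared by the induction hypothesis).
[cite: Wagner2008, Thm 4.6 (Rayleigh set systems are delta-matroids; down-closed case)] -/
theorem exists_insert_mem_of_card_lt :
    ∀ (k : ℕ) {𝓛 : Finset (Finset ι)}, IsRayleighFamily 𝓛 → IsLowerSet (𝓛 : Set (Finset ι)) →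
      ∀ {I J : Finset ι}, I ∈ 𝓛 → J ∈ 𝓛 → I.card = k → k < J.card → ∃ j ∈ J, j ∉ I ∧ insert j I ∈ 𝓛 := by
  classical
  intro k
  induction k with
  | zero =>
    intro 𝓛 _ hD I J _ hJ hI hJcard
    rw [Finset.card_eq_zero] at hI
    subst hI
    obtain ⟨j, hj⟩ := Finset.card_pos.mp hJcard
    exact ⟨j, hj, Finset.notMem_empty j, hD (show ({j} : Finset ι) ⊆ J by simpa using hj) hJ⟩
  | succ k ih =>
    intro 𝓛 h𝓛 hD I J hI hJ hIcard hJcard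
    by_cases hIJ : (I ∩ J).Nonempty
    · -- contract a common element
      obtain ⟨g, hg⟩ := hIJ
      rw [Finset.mem_inter] at hg
      obtain ⟨hgI, hgJ⟩ := hg
      have hAD : Disjoint ({g} : Finset ι) ∅ := disjoint_bot_right
      have hmem : ∀ T : Finset ι, T ∈ fminor {g} ∅ 𝓛 ↔ g ∉ T ∧ insert g T ∈ 𝓛 := fun T => by
        rw [mem_fminor hAD, Finset.union_empty, Finset.disjoint_singleton_left, union_singleton_eq_insert]
      have hI' : I.erase g ∈ fminor {g} ∅ 𝓛 :=
        (hmem _).mpr ⟨Finset.notMem_erase g I, by rwa [Finset.insert_erase hgI]⟩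
      have hJ' : J.erase g ∈ fminor {g} ∅ 𝓛 :=
        (hmem _).mpr ⟨Finset.notMem_erase g J, by rwa [Finset.insert_erase hgJ]⟩
      have hIc : (I.erase g).card = k := by rw [Finset.card_erase_of_mem hgI, hIcard]; rfl
      have hJc : k < (J.erase g).card := by
        rw [Finset.card_erase_of_mem hgJ]; omega
      obtain ⟨j, hjJ, hjI, hjins⟩ :=
        ih (isRayleighFamily_fminor h𝓛 hAD) (isLowerSet_fminor hD hAD) hI' hJ' hIc hJc
      have hjg : j ≠ g := Finset.ne_of_mem_erase hjJ
      refine ⟨j, Finset.mem_of_mem_erase hjJ, fun hjI' => hjI (Finset.mem_erase.mpr ⟨hjg, hjI'⟩), ?_⟩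
      have := ((hmem _).mp hjins).2
      rwa [Finset.insert_comm, Finset.insert_erase hgI] at this
    · -- disjoint case
      rw [Finset.not_nonempty_iff_eq_empty, ← Finset.disjoint_iff_inter_eq_empty] at hIJ
      obtain ⟨g, hgI⟩ : I.Nonempty := Finset.card_pos.mp (by omega)
      set I' := I.erase g with hI'def
      have hI'𝓛 : I' ∈ 𝓛 := hD (Finset.erase_subset g I) hI
      have hI'c : I'.card = k := by rw [hI'def, Finset.card_erase_of_mem hgI, hIcard]; rfl
      have hgI' : g ∉ I' := Finset.notMem_erase g I
      have hII' : insert g I' = I := Finset.insert_erase hgI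
      -- first new element
      obtain ⟨j₁, hj₁J, hj₁I', hj₁ins⟩ := ih h𝓛 hD hI'𝓛 hJ hI'c (by omega)
      have hj₁I : j₁ ∉ I := fun h => Finset.disjoint_left.mp hIJ h hj₁J
      have hgj₁ : g ≠ j₁ := fun h => hj₁I (h ▸ hgI)
      -- second new element, in the contraction by `j₁`
      have hAD : Disjoint ({j₁} : Finset ι) ∅ := disjoint_bot_right
      have hmem : ∀ T : Finset ι, T ∈ fminor {j₁} ∅ 𝓛 ↔ j₁ ∉ T ∧ insert j₁ T ∈ 𝓛 := fun T => by
        rw [mem_fminor hAD, Finset.union_empty, Finset.disjoint_singleton_left, union_singleton_eq_insert]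
      have hI'm : I' ∈ fminor {j₁} ∅ 𝓛 := (hmem _).mpr ⟨hj₁I', hj₁ins⟩
      have hJm : J.erase j₁ ∈ fminor {j₁} ∅ 𝓛 :=
        (hmem _).mpr ⟨Finset.notMem_erase j₁ J, by rwa [Finset.insert_erase hj₁J]⟩
      have hJc : k < (J.erase j₁).card := by rw [Finset.card_erase_of_mem hj₁J]; omega
      obtain ⟨j₂, hj₂J, hj₂I', hj₂ins⟩ :=
        ih (isRayleighFamily_fminor h𝓛 hAD) (isLowerSet_fminor hD hAD) hI'm hJm hI'c hJc
      have hj₁₂ : j₁ ≠ j₂ := (Finset.ne_of_mem_erase hj₂J).symm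
      have hj₂J' : j₂ ∈ J := Finset.mem_of_mem_erase hj₂J
      have hj₂I : j₂ ∉ I := fun h => Finset.disjoint_left.mp hIJ h hj₂J'
      have hgj₂ : g ≠ j₂ := fun h => hj₂I (h ▸ hgI)
      have hK : insert j₁ (insert j₂ I') ∈ 𝓛 := ((hmem _).mp hj₂ins).2
      -- the exchange step
      rcases insert_insert_mem_or h𝓛 hD hgI' hj₁I' hj₂I' hgj₁ hgj₂ hj₁₂ (hII'.symm ▸ hI) hK with h | h
      · exact ⟨j₁, hj₁J, hj₁I, by rwa [hII'] at h⟩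
      · exact ⟨j₂, hj₂J', hj₂I, by rwa [hII'] at h⟩

/-- **Rayleigh down-closed families are matroid complexes**: a nonempty down-closed family of finite sets whose coordinates are
pairwise non-positively correlated under every product measure conditioned on it is the family of independent sets of a matroid.
[cite: Wagner2008, Thm 4.6 (down-closed case)] -/
theorem exists_matroid_of_isRayleighFamily {𝓛 : Finset (Finset ι)} (h𝓛 : IsRayleighFamily 𝓛) (hD : IsLowerSet (𝓛 : Set (Finset ι)))
    (hne : 𝓛.Nonempty) : ∃ M : Matroid ι, ∀ I : Finset ι, M.Indep (↑I : Set ι) ↔ I ∈ 𝓛 := by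
  classical
  obtain ⟨S, hS⟩ := hne
  have h0 : (∅ : Finset ι) ∈ 𝓛 := hD (Finset.empty_subset S) hS
  let M : IndepMatroid ι := IndepMatroid.ofFinset (Set.univ : Set ι) (fun I => I ∈ 𝓛) h0
    (fun I J hJ hIJ => hD hIJ hJ)
    (fun I J hI hJ hcard => exists_insert_mem_of_card_lt I.card h𝓛 hD hI hJ rfl hcard)
    (fun I _ => Set.subset_univ _)
  refine ⟨M.matroid, fun I => ?_⟩
  rw [IndepMatroid.matroid_Indep]
  exact IndepMatroid.ofFinset_indep _ _ _ _ _ _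

end SahiOneStep

end Summit.CriticalPhenomena.PercolationContinuityZ3.Theorems
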